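import Summits.AtomisticToContinuum.Crystallization.Theorems.FrustratedLawDichotomyStrainedPatchHomEntryFitHcpKit

/-!
# The CENTRED (Lipschitz) fit leaf, real side: `1/20`-goodness of the centre for EVERY `(U, ξ)` of a box from fit data AT ONE POINT `(U₀, ξ₀)`
# (27623 strained-patch piece, `(H) HomFloor`; decomp-a2c hand-2 g27 — lever (D) of HAND2-G26.md §5 / critic row 1011 (B))

The (P1) fit leaves of the tree (`…HomEntryFit.goodAtScale_of_fitBounds` for the fcc family, `…HomEntryFitHcpKit.goodAtScale_of_fitBounds_hcp` for the
hcp family) take INTERVAL fit data valid for every deformation in a box; the kernel verdicts (`fitOK*`) produce them by interval arithmetic on Gram data,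
whose overestimation shrinks the accepted boxes to half-width `2⁻⁹` (`U`) / `2⁻⁸` (`ξ`) at the perfect lattice (HAND2-G26.md §4).  The deformed neighbours are
AFFINE in the deformation: `‖U q − U₀ q‖ ≤ ‖U − U₀‖` (`‖q‖ = 1`) and `‖nbrU U ξ k − nbrU U₀ ξ₀ k‖ ≤ ‖U − U₀‖(1 + ‖ξ₀‖ + εξ) + ‖U₀‖εξ`, so fit data at the
POINT `(U₀, ξ₀)` with margins `Δ` transfer to the whole box `‖U − U₀‖ ≤ εU`, `‖ξ − ξ₀‖ ≤ εξ`.  This DEF-FREE module proves exactly that transfer, with the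
conclusions of the two tree theorems verbatim (so `…HomPruned.pruneFcc_of_centre_good` / `pruneHcp_of_centre_good` consume them unchanged):

* §1 deviation lemmas (`norm_apply_sub_apply_le`, `norm_latPt_sub_latPt_le`, `norm_shifted_sub_shifted_le`, `norm_nbrU_sub_nbrU_le`);
* §2 ★ `goodAtScale_of_centredFitBounds` (fcc family): point data at `U₀` + `‖U − U₀‖ ≤ εU` ⟹ `GoodAtScale (1/20) (3/2)` at the centre of every locally
  `U·L_fcc` ball, for every `U` of the box;
* §3 ★ `goodAtScale_of_centredFitBounds_hcp` (hcp family, shuffles `‖ξ‖ ≤ 1/2`): point data at `(U₀, ξ₀)` + `‖U − U₀‖ ≤ εU`, `‖ξ − ξ₀‖ ≤ εξ`;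
* §4 the radius from the kernel's ENTRY box: `opNorm_le_sqrt_sum_sq` (Frobenius bound `‖A‖ ≤ √(Σ (A e_b)_a²)`), ★ `norm_sub_le_sqrt_of_entries`
  (`|U_{ab} − U₀_{ab}| ≤ ε_{ab}` ⟹ `‖U − U₀‖ ≤ √(Σ ε²)`), `norm_le_one_add_norm_sub_one` (`‖U₀‖ ≤ 1 + ‖U₀ − 1‖`).

The margins: lower scale bound `dlo + Δ`, upper `dhi − Δ`, fit residual `≤ 49/1000·dlo − 2Δ`, clean bound `13/10·dlo − 1/100 − Δ`, off-shell far bounds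
`+ εU·‖P b‖` (fcc / hcp `A` family) and `+ εU·(‖P b + t + ξ₀‖ + εξ) + ‖U₀‖εξ` (hcp `B` family).  A kernel verdict evaluating the existing Gram checks on the
POINT box `(c, 0)` with these shifted thresholds is sound by these theorems (successor work; expected gain ×2⁶ in the six `U`-coordinates of the tight core).
0 sorry; no definitions; axioms ⊆ {propext, Classical.choice, Quot.sound}; no instances / notation.  `--supports stmt-AtomisticToContinuum-27623`.
-/

noncomputable section

namespace Summit.AtomisticToContinuum.Crystallization.Theorems.FrustratedLawDichotomyStrainedPatchHomEntryFitCentred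

open scoped BigOperators RealInnerProductSpace
open Literature.Geometry.DiscreteGeometry (fccKissingPattern fccInt hcpKissingPattern norm_eq_one_of_mem_fccKissingPattern)
open Summit.AtomisticToContinuum.Crystallization.Theorems.ChargedEnergyGapNegative (E3)
open Summit.AtomisticToContinuum.Crystallization.Theorems.FrustratedLawDichotomyMotifLemmas (GoodAtScale)
open Summit.AtomisticToContinuum.Crystallization.Theorems.FrustratedLawDichotomyStrainedPatchHomSplit
open Summit.AtomisticToContinuum.Crystallization.Theorems.FrustratedLawDichotomyStrainedPatchHomLatticeBoxHcp (latPt_eq_apply_one shifted_eq_apply)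
open Summit.AtomisticToContinuum.Crystallization.Theorems.FrustratedLawDichotomyStrainedPatchHomEntryFitKit (recon)
open Summit.AtomisticToContinuum.Crystallization.Theorems.FrustratedLawDichotomyStrainedPatchHomEntryFit (goodAtScale_of_fitBounds)
open Summit.AtomisticToContinuum.Crystallization.Theorems.FrustratedLawDichotomyStrainedPatchHomEntryHcpFrame (hlab hshift nbr norm_nbr nbrU nbrU_eq)
open Summit.AtomisticToContinuum.Crystallization.Theorems.FrustratedLawDichotomyStrainedPatchHomEntryFitHcpKit (goodAtScale_of_fitBounds_hcp)
open Literature.Barriers.AtomisticToContinuum.FlatleyTheil2015 (fccVec)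

/-! ## §1. Deviation lemmas: the deformed neighbours are affine in the deformation -/

/-- `‖U v − U₀ v‖ ≤ ‖U − U₀‖·‖v‖`. [formal bookkeeping] -/
theorem norm_apply_sub_apply_le (U U₀ : E3 →L[ℝ] E3) (v : E3) : ‖U v - U₀ v‖ ≤ ‖U - U₀‖ * ‖v‖ :=
  calc ‖U v - U₀ v‖ = ‖(U - U₀) v‖ := rfl
    _ ≤ ‖U - U₀‖ * ‖v‖ := (U - U₀).le_opNorm v

/-- Lattice points move by at most `‖U − U₀‖·‖P b‖`: `‖latPt U f b − latPt U₀ f b‖ ≤ ‖U − U₀‖·‖latPt 1 f b‖`. [formal bookkeeping] -/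
theorem norm_latPt_sub_latPt_le (U U₀ : E3 →L[ℝ] E3) (f : Fin 3 → E3) (b : Fin 3 → ℤ) :
    ‖latPt U f b - latPt U₀ f b‖ ≤ ‖U - U₀‖ * ‖latPt 1 f b‖ := by
  rw [latPt_eq_apply_one U, latPt_eq_apply_one U₀]
  exact norm_apply_sub_apply_le U U₀ _

/-- Shifted (`B`-sublattice) points: `‖(latPt U b + U(t + ξ)) − (latPt U₀ b + U₀(t + ξ₀))‖ ≤ ‖U − U₀‖·‖P b + t + ξ‖ + ‖U₀‖·‖ξ − ξ₀‖`.
[formal bookkeeping] -/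
theorem norm_shifted_sub_shifted_le (U U₀ : E3 →L[ℝ] E3) (ξ ξ₀ : E3) (b : Fin 3 → ℤ) :
    ‖(latPt U hexFrame b + U (hcpShift + ξ)) - (latPt U₀ hexFrame b + U₀ (hcpShift + ξ₀))‖ ≤
      ‖U - U₀‖ * ‖latPt 1 hexFrame b + hcpShift + ξ‖ + ‖U₀‖ * ‖ξ - ξ₀‖ := by
  rw [shifted_eq_apply, shifted_eq_apply]
  have hsplit : U (latPt 1 hexFrame b + hcpShift + ξ) - U₀ (latPt 1 hexFrame b + hcpShift + ξ₀) =
      (U (latPt 1 hexFrame b + hcpShift + ξ) - U₀ (latPt 1 hexFrame b + hcpShift + ξ)) + U₀ (ξ - ξ₀) := by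
    simp only [map_add, map_sub]; abel
  rw [hsplit]
  refine (norm_add_le _ _).trans (add_le_add (norm_apply_sub_apply_le U U₀ _) (U₀.le_opNorm _))

/-- The shifted far bound with the shuffle replaced by the reference shuffle: `‖P b + t + ξ‖ ≤ ‖P b + t + ξ₀‖ + ‖ξ − ξ₀‖`. [formal bookkeeping] -/
theorem norm_shifted_arg_le (ξ ξ₀ : E3) (b : Fin 3 → ℤ) :
    ‖latPt 1 hexFrame b + hcpShift + ξ‖ ≤ ‖latPt 1 hexFrame b + hcpShift + ξ₀‖ + ‖ξ - ξ₀‖ := by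
  have h : latPt 1 hexFrame b + hcpShift + ξ = (latPt 1 hexFrame b + hcpShift + ξ₀) + (ξ - ξ₀) := by abel
  rw [h]
  exact norm_add_le _ _

/-- ★ The twelve deformed hcp neighbours are affine in `(U, ξ)`: `‖nbrU U ξ k − nbrU U₀ ξ₀ k‖ ≤ ‖U − U₀‖·(1 + ‖ξ‖) + ‖U₀‖·‖ξ − ξ₀‖`
(`A` neighbours: `≤ ‖U − U₀‖`). [folklore] -/
theorem norm_nbrU_sub_nbrU_le (U U₀ : E3 →L[ℝ] E3) (ξ ξ₀ : E3) (k : Fin 12) :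
    ‖nbrU U ξ k - nbrU U₀ ξ₀ k‖ ≤ ‖U - U₀‖ * (1 + ‖ξ‖) + ‖U₀‖ * ‖ξ - ξ₀‖ := by
  rw [nbrU_eq U ξ k, nbrU_eq U₀ ξ₀ k]
  have h1 : ‖U (nbr k) - U₀ (nbr k)‖ ≤ ‖U - U₀‖ := by
    have := norm_apply_sub_apply_le U U₀ (nbr k)
    rwa [norm_nbr, mul_one] at this
  have hU0 : 0 ≤ ‖U - U₀‖ := norm_nonneg _
  have hU₀0 : 0 ≤ ‖U₀‖ := norm_nonneg _
  have hξ0 : 0 ≤ ‖ξ‖ := norm_nonneg _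
  have hd0 : 0 ≤ ‖ξ - ξ₀‖ := norm_nonneg _
  cases hshift k
  · simp only [Bool.false_eq_true, ↓reduceIte, add_zero]
    nlinarith [h1]
  · simp only [↓reduceIte]
    have hsplit : U (nbr k) + U ξ - (U₀ (nbr k) + U₀ ξ₀) = (U (nbr k) - U₀ (nbr k)) + ((U ξ - U₀ ξ) + U₀ (ξ - ξ₀)) := by
      simp only [map_sub]; abel
    rw [hsplit]
    have h2 : ‖U ξ - U₀ ξ‖ ≤ ‖U - U₀‖ * ‖ξ‖ := norm_apply_sub_apply_le U U₀ ξ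
    have h3 : ‖U₀ (ξ - ξ₀)‖ ≤ ‖U₀‖ * ‖ξ - ξ₀‖ := U₀.le_opNorm _
    calc ‖U (nbr k) - U₀ (nbr k) + (U ξ - U₀ ξ + U₀ (ξ - ξ₀))‖
        ≤ ‖U (nbr k) - U₀ (nbr k)‖ + (‖U ξ - U₀ ξ‖ + ‖U₀ (ξ - ξ₀)‖) :=
          (norm_add_le _ _).trans (add_le_add le_rfl (norm_add_le _ _))
      _ ≤ ‖U - U₀‖ * (1 + ‖ξ‖) + ‖U₀‖ * ‖ξ - ξ₀‖ := by nlinarith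

/-- The uniform deviation bound over the box `‖U − U₀‖ ≤ εU`, `‖ξ − ξ₀‖ ≤ εξ`: `‖nbrU U ξ k − nbrU U₀ ξ₀ k‖ ≤ εU·(1 + ‖ξ₀‖ + εξ) + ‖U₀‖·εξ`.
[folklore] -/
theorem norm_nbrU_sub_nbrU_le_of_box {U U₀ : E3 →L[ℝ] E3} {ξ ξ₀ : E3} {εU εξ : ℝ} (hεU : ‖U - U₀‖ ≤ εU) (hεξ : ‖ξ - ξ₀‖ ≤ εξ)
    (k : Fin 12) : ‖nbrU U ξ k - nbrU U₀ ξ₀ k‖ ≤ εU * (1 + ‖ξ₀‖ + εξ) + ‖U₀‖ * εξ := by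
  have h := norm_nbrU_sub_nbrU_le U U₀ ξ ξ₀ k
  have hξ : ‖ξ‖ ≤ ‖ξ₀‖ + εξ := by
    have := norm_le_insert' ξ ξ₀
    -- `‖ξ‖ ≤ ‖ξ₀‖ + ‖ξ - ξ₀‖`
    linarith [norm_sub_rev ξ ξ₀]
  have hU0 : 0 ≤ ‖U - U₀‖ := norm_nonneg _
  have hU₀0 : 0 ≤ ‖U₀‖ := norm_nonneg _
  have hξ00 : 0 ≤ ‖ξ₀‖ := norm_nonneg _
  have hε0 : 0 ≤ εξ := (norm_nonneg _).trans hεξ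
  nlinarith

/-! ## §2. The centred fit leaf, fcc family -/

/-- ★ **CENTRE `1/20`-GOOD FROM CENTRED FIT BOUNDS (fcc family).**  Fit data at ONE deformation `U₀` with margin `Δ ≥ εU` (lower scale bound `dlo + Δ`,
upper `dhi − Δ`, residuals `≤ 49/1000·dlo − 2Δ`, clean bound `13/10·dlo − 1/100 − Δ`, off-shell far bounds `13/10·dhi + 1/100 + εU‖P b‖`) give the
conclusion of `…HomEntryFit.goodAtScale_of_fitBounds` for EVERY `U` with `‖U − 1‖ ≤ 1/4` and `‖U − U₀‖ ≤ εU`. [folklore] -/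
theorem goodAtScale_of_centredFitBounds (U U₀ : E3 →L[ℝ] E3) (hU : ‖U - 1‖ ≤ 1 / 4) {εU Δ : ℝ} (hεU : ‖U - U₀‖ ≤ εU) (hΔ : εU ≤ Δ)
    {dlo dhi : ℝ} (hdlo : 0 < dlo) (hdhi : dhi ≤ 3 / 2) (hthr : 8 * (13 / 10 * dhi + 1 / 100) ^ 2 < 27)
    (hlo : ∀ q ∈ fccKissingPattern, dlo + Δ ≤ ‖U₀ q‖) (hhi : ∃ q ∈ fccKissingPattern, ‖U₀ q‖ ≤ dhi - Δ)
    (hfit : ∀ q ∈ fccKissingPattern, ∀ q' ∈ fccKissingPattern, ‖U₀ q - ‖U₀ q'‖ • q‖ ≤ 49 / 1000 * dlo - 2 * Δ)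
    (hcl : ∀ q ∈ fccKissingPattern, ‖U₀ q‖ ≤ 13 / 10 * dlo - 1 / 100 - Δ)
    (hfar : ∀ b ∈ (Fintype.piFinset fun _ : Fin 3 => Finset.Icc (-2 : ℤ) 2), b ≠ 0 → recon b ∉ fccInt →
      13 / 10 * dhi + 1 / 100 + εU * ‖latPt 1 fccVec b‖ ≤ ‖latPt U₀ fccVec b‖) :
    ∀ (M : ℕ) (z : Fin M → E3) (c : Fin M), Function.Injective z →
      (∀ x : E3, dist x (z c) < 15 / 2 → (x ∈ Set.range z ↔ x - z c ∈ {v : E3 | ∃ b : Fin 3 → ℤ, v = latPt U fccVec b})) →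
      GoodAtScale (1 / 20) (3 / 2) z c := by
  -- every pattern neighbour moves by at most `εU ≤ Δ`
  have hdev : ∀ q ∈ fccKissingPattern, ‖U q - U₀ q‖ ≤ Δ := fun q hq => by
    have := norm_apply_sub_apply_le U U₀ q
    rw [norm_eq_one_of_mem_fccKissingPattern hq, mul_one] at this
    exact this.trans (hεU.trans hΔ)
  have hup : ∀ q ∈ fccKissingPattern, ‖U q‖ ≤ ‖U₀ q‖ + Δ := fun q hq => by
    have := norm_le_insert' (U q) (U₀ q)
    linarith [hdev q hq, norm_sub_rev (U q) (U₀ q)]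
  have hdn : ∀ q ∈ fccKissingPattern, ‖U₀ q‖ - Δ ≤ ‖U q‖ := fun q hq => by
    have := norm_le_insert' (U₀ q) (U q)
    linarith [hdev q hq, norm_sub_rev (U₀ q) (U q)]
  have hlo' : ∀ q ∈ fccKissingPattern, dlo ≤ ‖U q‖ := fun q hq => by linarith [hlo q hq, hdn q hq]
  refine goodAtScale_of_fitBounds U hU hdlo hdhi hthr hlo' ?_ (d2lo := dlo ^ 2) ?_ ?_ ?_ ?_
  · obtain ⟨q, hq, h⟩ := hhi
    exact ⟨q, hq, by linarith [hup q hq]⟩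
  · intro q hq
    have := hlo' q hq
    nlinarith
  · intro q hq q' hq'
    -- `‖U q − ‖U q'‖•q‖ ≤ ‖U₀ q − ‖U₀ q'‖•q‖ + ‖U q − U₀ q‖ + |‖U q'‖ − ‖U₀ q'‖| ≤ 49/1000·dlo`
    have hq1 : ‖q‖ = 1 := norm_eq_one_of_mem_fccKissingPattern hq
    have hsplit : U q - ‖U q'‖ • q = (U₀ q - ‖U₀ q'‖ • q) + ((U q - U₀ q) - (‖U q'‖ - ‖U₀ q'‖) • q) := by
      rw [sub_smul]; abel
    have hn : ‖(‖U q'‖ - ‖U₀ q'‖) • q‖ ≤ Δ := by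
      rw [norm_smul, hq1, mul_one, Real.norm_eq_abs]
      exact (abs_norm_sub_norm_le (U q') (U₀ q')).trans (hdev q' hq')
    have hle : ‖U q - ‖U q'‖ • q‖ ≤ 49 / 1000 * dlo := by
      rw [hsplit]
      refine (norm_add_le _ _).trans ?_
      have := norm_sub_le (U q - U₀ q) ((‖U q'‖ - ‖U₀ q'‖) • q)
      linarith [hfit q hq q' hq', hdev q hq]
    have h0 : 0 ≤ ‖U q - ‖U q'‖ • q‖ := norm_nonneg _
    have := mul_self_le_mul_self h0 hle
    nlinarith
  · intro q hq
    linarith [hup q hq, hcl q hq]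
  · intro b hb hb0 hbi
    have hmove := norm_latPt_sub_latPt_le U U₀ fccVec b
    have htri : ‖latPt U₀ fccVec b‖ ≤ ‖latPt U fccVec b‖ + ‖latPt U fccVec b - latPt U₀ fccVec b‖ := by
      have := norm_le_insert' (latPt U₀ fccVec b) (latPt U fccVec b)
      linarith [norm_sub_rev (latPt U fccVec b) (latPt U₀ fccVec b)]
    have hP0 : 0 ≤ ‖latPt 1 fccVec b‖ := norm_nonneg _
    have hεmul : ‖U - U₀‖ * ‖latPt 1 fccVec b‖ ≤ εU * ‖latPt 1 fccVec b‖ := mul_le_mul_of_nonneg_right hεU hP0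
    linarith [hfar b hb hb0 hbi]

/-! ## §3. The centred fit leaf, hcp family -/

/-- ★ **CENTRE `1/20`-GOOD FROM CENTRED FIT BOUNDS (hcp family, shuffles `‖ξ‖ ≤ 1/2`).**  Fit data at ONE point `(U₀, ξ₀)` with a margin
`Δ ≥ εU·(1 + ‖ξ₀‖ + εξ) + ‖U₀‖·εξ` (the uniform bound of `norm_nbrU_sub_nbrU_le_of_box`) give the conclusion of
`…HomEntryFitHcpKit.goodAtScale_of_fitBounds_hcp` for EVERY `(U, ξ)` with `‖U − 1‖ ≤ 1/4`, `‖ξ‖ ≤ 1/2`, `‖U − U₀‖ ≤ εU`, `‖ξ − ξ₀‖ ≤ εξ`.  Off-shell far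
bounds: `A` family `+ εU‖P b‖`, `B` family `+ εU(‖P b + t + ξ₀‖ + εξ) + ‖U₀‖εξ`. [folklore] -/
theorem goodAtScale_of_centredFitBounds_hcp (U U₀ : E3 →L[ℝ] E3) (ξ ξ₀ : E3) (hU : ‖U - 1‖ ≤ 1 / 4) (hξ : ‖ξ‖ ≤ 1 / 2) {εU εξ Δ : ℝ}
    (hεU : ‖U - U₀‖ ≤ εU) (hεξ : ‖ξ - ξ₀‖ ≤ εξ) (hΔ : εU * (1 + ‖ξ₀‖ + εξ) + ‖U₀‖ * εξ ≤ Δ)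
    {dlo dhi : ℝ} (hdlo : 0 < dlo) (hdhi : dhi ≤ 3 / 2)
    (hlo : ∀ k, dlo + Δ ≤ ‖nbrU U₀ ξ₀ k‖) (hhi : ∃ k, ‖nbrU U₀ ξ₀ k‖ ≤ dhi - Δ)
    (hfit : ∀ k k', ‖nbrU U₀ ξ₀ k - ‖nbrU U₀ ξ₀ k'‖ • nbr k‖ ≤ 49 / 1000 * dlo - 2 * Δ)
    (hcl : ∀ k, ‖nbrU U₀ ξ₀ k‖ ≤ 13 / 10 * dlo - 1 / 100 - Δ)
    (hfarA : ∀ b ∈ (Fintype.piFinset fun _ : Fin 3 => Finset.Icc (-7 : ℤ) 7), b ≠ 0 → (∀ k, hshift k = false → hlab k ≠ b) →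
      13 / 10 * dhi + 1 / 100 + εU * ‖latPt 1 hexFrame b‖ ≤ ‖latPt U₀ hexFrame b‖)
    (hfarB : ∀ b ∈ (Fintype.piFinset fun _ : Fin 3 => Finset.Icc (-7 : ℤ) 7), (∀ k, hshift k = true → hlab k ≠ b) →
      13 / 10 * dhi + 1 / 100 + (εU * (‖latPt 1 hexFrame b + hcpShift + ξ₀‖ + εξ) + ‖U₀‖ * εξ) ≤
        ‖latPt U₀ hexFrame b + U₀ (hcpShift + ξ₀)‖) :
    ∀ (M : ℕ) (z : Fin M → E3) (c : Fin M), Function.Injective z →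
      (∀ x : E3, dist x (z c) < 15 / 2 → (x ∈ Set.range z ↔
        x - z c ∈ {v : E3 | ∃ b : Fin 3 → ℤ, v = latPt U hexFrame b ∨ v = latPt U hexFrame b + U (hcpShift + ξ)})) →
      GoodAtScale (1 / 20) (3 / 2) z c := by
  have hdev : ∀ k, ‖nbrU U ξ k - nbrU U₀ ξ₀ k‖ ≤ Δ := fun k => (norm_nbrU_sub_nbrU_le_of_box hεU hεξ k).trans hΔ
  have hup : ∀ k, ‖nbrU U ξ k‖ ≤ ‖nbrU U₀ ξ₀ k‖ + Δ := fun k => by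
    have := norm_le_insert' (nbrU U ξ k) (nbrU U₀ ξ₀ k)
    linarith [hdev k, norm_sub_rev (nbrU U ξ k) (nbrU U₀ ξ₀ k)]
  have hdn : ∀ k, ‖nbrU U₀ ξ₀ k‖ - Δ ≤ ‖nbrU U ξ k‖ := fun k => by
    have := norm_le_insert' (nbrU U₀ ξ₀ k) (nbrU U ξ k)
    linarith [hdev k, norm_sub_rev (nbrU U₀ ξ₀ k) (nbrU U ξ k)]
  have hlo' : ∀ k, dlo ≤ ‖nbrU U ξ k‖ := fun k => by linarith [hlo k, hdn k]
  have hεU0 : 0 ≤ εU := (norm_nonneg _).trans hεU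
  have hεξ0 : 0 ≤ εξ := (norm_nonneg _).trans hεξ
  refine goodAtScale_of_fitBounds_hcp U ξ hU hξ hdlo hdhi hlo' ?_ (d2lo := dlo ^ 2) ?_ ?_ ?_ ?_ ?_
  · obtain ⟨k, h⟩ := hhi
    exact ⟨k, by linarith [hup k]⟩
  · intro k
    have := hlo' k
    nlinarith
  · intro k k'
    have hsplit : nbrU U ξ k - ‖nbrU U ξ k'‖ • nbr k =
        (nbrU U₀ ξ₀ k - ‖nbrU U₀ ξ₀ k'‖ • nbr k) + ((nbrU U ξ k - nbrU U₀ ξ₀ k) - (‖nbrU U ξ k'‖ - ‖nbrU U₀ ξ₀ k'‖) • nbr k) := by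
      rw [sub_smul]; abel
    have hn : ‖(‖nbrU U ξ k'‖ - ‖nbrU U₀ ξ₀ k'‖) • nbr k‖ ≤ Δ := by
      rw [norm_smul, norm_nbr, mul_one, Real.norm_eq_abs]
      exact (abs_norm_sub_norm_le _ _).trans (hdev k')
    have hle : ‖nbrU U ξ k - ‖nbrU U ξ k'‖ • nbr k‖ ≤ 49 / 1000 * dlo := by
      rw [hsplit]
      refine (norm_add_le _ _).trans ?_
      have := norm_sub_le (nbrU U ξ k - nbrU U₀ ξ₀ k) ((‖nbrU U ξ k'‖ - ‖nbrU U₀ ξ₀ k'‖) • nbr k)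
      linarith [hfit k k', hdev k]
    have h0 : 0 ≤ ‖nbrU U ξ k - ‖nbrU U ξ k'‖ • nbr k‖ := norm_nonneg _
    have := mul_self_le_mul_self h0 hle
    nlinarith
  · intro k
    linarith [hup k, hcl k]
  · intro b hb hb0 hbl
    have hmove := norm_latPt_sub_latPt_le U U₀ hexFrame b
    have htri : ‖latPt U₀ hexFrame b‖ ≤ ‖latPt U hexFrame b‖ + ‖latPt U hexFrame b - latPt U₀ hexFrame b‖ := by
      have := norm_le_insert' (latPt U₀ hexFrame b) (latPt U hexFrame b)
      linarith [norm_sub_rev (latPt U hexFrame b) (latPt U₀ hexFrame b)]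
    have hP0 : 0 ≤ ‖latPt 1 hexFrame b‖ := norm_nonneg _
    have hεmul : ‖U - U₀‖ * ‖latPt 1 hexFrame b‖ ≤ εU * ‖latPt 1 hexFrame b‖ := mul_le_mul_of_nonneg_right hεU hP0
    linarith [hfarA b hb hb0 hbl]
  · intro b hb hbl
    have hmove := norm_shifted_sub_shifted_le U U₀ ξ ξ₀ b
    have harg := norm_shifted_arg_le ξ ξ₀ b
    have htri : ‖latPt U₀ hexFrame b + U₀ (hcpShift + ξ₀)‖ ≤ ‖latPt U hexFrame b + U (hcpShift + ξ)‖ +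
        ‖(latPt U hexFrame b + U (hcpShift + ξ)) - (latPt U₀ hexFrame b + U₀ (hcpShift + ξ₀))‖ := by
      have := norm_le_insert' (latPt U₀ hexFrame b + U₀ (hcpShift + ξ₀)) (latPt U hexFrame b + U (hcpShift + ξ))
      linarith [norm_sub_rev (latPt U hexFrame b + U (hcpShift + ξ)) (latPt U₀ hexFrame b + U₀ (hcpShift + ξ₀))]
    have hU0 : 0 ≤ ‖U - U₀‖ := norm_nonneg _
    have hU₀0 : 0 ≤ ‖U₀‖ := norm_nonneg _
    have hP0 : 0 ≤ ‖latPt 1 hexFrame b + hcpShift + ξ₀‖ := norm_nonneg _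
    have h1 : ‖U - U₀‖ * ‖latPt 1 hexFrame b + hcpShift + ξ‖ ≤ εU * (‖latPt 1 hexFrame b + hcpShift + ξ₀‖ + εξ) := by
      have ha : ‖latPt 1 hexFrame b + hcpShift + ξ‖ ≤ ‖latPt 1 hexFrame b + hcpShift + ξ₀‖ + εξ := harg.trans (by linarith)
      have hb' : 0 ≤ ‖latPt 1 hexFrame b + hcpShift + ξ‖ := norm_nonneg _
      calc ‖U - U₀‖ * ‖latPt 1 hexFrame b + hcpShift + ξ‖ ≤ εU * ‖latPt 1 hexFrame b + hcpShift + ξ‖ :=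
            mul_le_mul_of_nonneg_right hεU hb'
        _ ≤ εU * (‖latPt 1 hexFrame b + hcpShift + ξ₀‖ + εξ) := mul_le_mul_of_nonneg_left ha hεU0
    have h2 : ‖U₀‖ * ‖ξ - ξ₀‖ ≤ ‖U₀‖ * εξ := mul_le_mul_of_nonneg_left hεξ hU₀0
    linarith [hfarB b hb hbl]

/-! ## §4. From the entry box to the operator-norm radius `εU` (Frobenius bound) -/

/-- The coordinates of `A v` in terms of the matrix entries `(A e_b)_a`: `(A v)_a = Σ_b v_b · (A e_b)_a`. [formal bookkeeping] -/
theorem apply_coord_eq_sum (A : E3 →L[ℝ] E3) (v : E3) (a : Fin 3) :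
    (A v) a = ∑ b : Fin 3, v b * (A (EuclideanSpace.single b (1 : ℝ))) a := by
  have hv : v = ∑ b : Fin 3, v b • EuclideanSpace.single b (1 : ℝ) := by
    simpa using ((EuclideanSpace.basisFun (Fin 3) ℝ).sum_repr v).symm
  conv_lhs => rw [hv]
  simp [map_sum, map_smul, Finset.sum_apply, smul_eq_mul]

/-- ★ **FROBENIUS BOUND**: `‖A‖ ≤ √(Σ_{a,b} (A e_b)_a²)` for a linear map of `ℝ³`. [folklore] -/
theorem opNorm_le_sqrt_sum_sq (A : E3 →L[ℝ] E3) :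
    ‖A‖ ≤ Real.sqrt (∑ a : Fin 3, ∑ b : Fin 3, ((A (EuclideanSpace.single b (1 : ℝ))) a) ^ 2) := by
  set F : ℝ := ∑ a : Fin 3, ∑ b : Fin 3, ((A (EuclideanSpace.single b (1 : ℝ))) a) ^ 2 with hF
  have hF0 : 0 ≤ F := by rw [hF]; positivity
  refine ContinuousLinearMap.opNorm_le_bound _ (Real.sqrt_nonneg _) fun v => ?_
  have h1 : ‖A v‖ ^ 2 = ∑ a : Fin 3, ((A v) a) ^ 2 := by
    rw [EuclideanSpace.norm_eq, Real.sq_sqrt (by positivity)]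
    simp [Real.norm_eq_abs, sq_abs]
  have h2 : ‖v‖ ^ 2 = ∑ b : Fin 3, (v b) ^ 2 := by
    rw [EuclideanSpace.norm_eq, Real.sq_sqrt (by positivity)]
    simp [Real.norm_eq_abs, sq_abs]
  have h3 : ‖A v‖ ^ 2 ≤ F * ‖v‖ ^ 2 := by
    rw [h1, h2, hF, Finset.sum_mul]
    refine Finset.sum_le_sum fun a _ => ?_
    rw [apply_coord_eq_sum A v a, mul_comm]
    exact Finset.sum_mul_sq_le_sq_mul_sq _ _ _
  have hv0 : 0 ≤ ‖v‖ := norm_nonneg _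
  have hsq : ‖A v‖ ^ 2 ≤ (Real.sqrt F * ‖v‖) ^ 2 := by
    rw [mul_pow, Real.sq_sqrt hF0]; exact h3
  exact (abs_le_of_sq_le_sq' hsq (by positivity)).2

/-- ★ **THE ENTRY BOX GIVES THE RADIUS**: entrywise `|(U e_b)_a − (U₀ e_b)_a| ≤ ε_{ab}` ⟹ `‖U − U₀‖ ≤ √(Σ_{a,b} ε_{ab}²)` (so a kernel box of
entry half-widths `w_{ab}/SC` about `c/SC` has `εU = √(Σ w²)/SC`, `= 3w/SC` for uniform widths). [folklore] -/
theorem norm_sub_le_sqrt_of_entries {U U₀ : E3 →L[ℝ] E3} {ε : Fin 3 → Fin 3 → ℝ}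
    (h : ∀ a b : Fin 3, |(U (EuclideanSpace.single b (1 : ℝ))) a - (U₀ (EuclideanSpace.single b (1 : ℝ))) a| ≤ ε a b) :
    ‖U - U₀‖ ≤ Real.sqrt (∑ a : Fin 3, ∑ b : Fin 3, (ε a b) ^ 2) := by
  refine (opNorm_le_sqrt_sum_sq (U - U₀)).trans (Real.sqrt_le_sqrt (Finset.sum_le_sum fun a _ => Finset.sum_le_sum fun b _ => ?_))
  have hab := h a b
  have he : ((U - U₀) (EuclideanSpace.single b (1 : ℝ))) a = (U (EuclideanSpace.single b (1 : ℝ))) a - (U₀ (EuclideanSpace.single b (1 : ℝ))) a := rfl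
  rw [he]
  have h0 : 0 ≤ ε a b := (abs_nonneg _).trans hab
  exact sq_le_sq' (by linarith [(abs_le.1 hab).1]) (abs_le.1 hab).2

/-- `‖U₀‖ ≤ 1 + ‖U₀ − 1‖` — the operator norm of the reference point from its distance to the identity (`≤ 5/4` on the entry domain).
[formal bookkeeping] -/
theorem norm_le_one_add_norm_sub_one (U₀ : E3 →L[ℝ] E3) : ‖U₀‖ ≤ 1 + ‖U₀ - 1‖ := by
  have e : (1 : E3 →L[ℝ] E3) + (U₀ - 1) = U₀ := by abel
  calc ‖U₀‖ = ‖(1 : E3 →L[ℝ] E3) + (U₀ - 1)‖ := by rw [e]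
    _ ≤ ‖(1 : E3 →L[ℝ] E3)‖ + ‖U₀ - 1‖ := norm_add_le _ _
    _ = 1 + ‖U₀ - 1‖ := by rw [norm_one]

end Summit.AtomisticToContinuum.Crystallization.Theorems.FrustratedLawDichotomyStrainedPatchHomEntryFitCentred
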